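import Summits.FinalStateConjecture.FinalStateConjecture.Theorems.PhotonSphereChannelsDuhamelEstimates

/-!
# Route PhotonSphereChannels — the Picard iterates of the Cauchy problem (well-posedness, IV)

For `V ∈ C¹` and a free solution `ψ₀ ∈ C²` the Picard iterates `δ 0 = ψ₀`,
`δ (n+1) = D(−V δ n)` (Duhamel operator, passed by its formula) are all `C²` (`contDiff_picard`;
the source `−Vδ n` is `C¹`, `contDiff_one_source`, and `D` gains a derivative), satisfy
`□ δ (n+1) = −V δ n` (`wave_picard_succ`) with zero Cauchy data (`picard_succ_zero`), and on every
light-cone triangle `{|x| + |t| ≤ R}` obey the geometric bounds (`picard_bounds`)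
`|δ n|, |∂δ n (v)|/(|v₁|+|v₂|), |∂²δ n (v)(w)|/((|v₁|+|v₂|)(|w₁|+|w₂|)) ≤ A · 2⁻ⁿ · e^{L|t|}`,
`L = 2RK₀ + 1`, `K₀ = sup_{|x|≤R}|V|` (weighted-in-time contraction; compactness of the triangle,
`isCompact_triangle`, bounds `ψ₀` and its first two derivatives).  Towards stub `stub_rwCauchy`
(crux stmt-FinalStateConjecture-10045) / `BlindnessInsidePhotonSphere` (stmt-…-10049).
No new definitions. [folklore]
-/

namespace Summit.FinalStateConjecture.FinalStateConjecture.Theorems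

open MeasureTheory Set Filter Topology intervalIntegral
open scoped ContDiff Interval

noncomputable section

namespace WaveEnergy

/-! ### The Picard iterates: regularity, equations, data, and geometric bounds -/

section Picard

variable {V : ℝ → ℝ} {ψ₀ : ℝ × ℝ → ℝ} {δ : ℕ → ℝ × ℝ → ℝ}

/-- The source term `G = −V·u` of the Picard step is `C¹` for `V ∈ C¹`, `u ∈ C²`. -/
theorem contDiff_one_source (hV : ContDiff ℝ 1 V) {u : ℝ × ℝ → ℝ} (hu : ContDiff ℝ 2 u) :
    ContDiff ℝ 1 fun z : ℝ × ℝ => -(V z.2 * u z) :=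
  ((hV.comp contDiff_snd).mul (hu.of_le (by norm_cast))).neg

/-- The `x`-partial of the source term: `∂₂(−V u)(z) = −(V'(x) u(z) + V(x) ∂₂u(z))`. -/
theorem fderiv_source_apply (hV : ContDiff ℝ 1 V) {u : ℝ × ℝ → ℝ} (hu : Differentiable ℝ u)
    (z : ℝ × ℝ) :
    fderiv ℝ (fun z : ℝ × ℝ => -(V z.2 * u z)) z (0, 1) = -(deriv V z.2 * u z + V z.2 * fderiv ℝ u z (0, 1)) := by
  have hVd : Differentiable ℝ V := hV.differentiable (by simp)
  have h1 : HasFDerivAt (fun z : ℝ × ℝ => V z.2)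
      ((fderiv ℝ V z.2).comp (ContinuousLinearMap.snd ℝ ℝ ℝ)) z :=
    (hVd z.2).hasFDerivAt.comp z hasFDerivAt_snd
  have h2 : HasFDerivAt (fun z : ℝ × ℝ => -(V z.2 * u z))
      (-(V z.2 • fderiv ℝ u z + u z • (fderiv ℝ V z.2).comp (ContinuousLinearMap.snd ℝ ℝ ℝ))) z :=
    (h1.mul (hu z).hasFDerivAt).neg
  rw [h2.fderiv]
  simp only [neg_apply, add_apply, smul_apply, ContinuousLinearMap.coe_comp,
    Function.comp_apply, ContinuousLinearMap.coe_snd', smul_eq_mul]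
  have : fderiv ℝ V z.2 (1 : ℝ) = deriv V z.2 := by simp [fderiv_eq_smul_deriv]
  rw [this]
  ring

/-- **Regularity of the Picard iterates**: all `δ n` are `C²` (`V ∈ C¹`, `ψ₀ ∈ C²`; the Duhamel
operator gains one derivative). -/
theorem contDiff_picard (hV : ContDiff ℝ 1 V) (hψ₀ : ContDiff ℝ 2 ψ₀) (hδ0 : δ 0 = ψ₀)
    (hδ : ∀ n t x, δ (n + 1) (t, x) = (1 / 2) * ∫ s in (0 : ℝ)..t,
      ((∫ y in (0 : ℝ)..(x + (t - s)), -(V y * δ n (s, y)))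
        - ∫ y in (0 : ℝ)..(x - (t - s)), -(V y * δ n (s, y)))) :
    ∀ n, ContDiff ℝ 2 (δ n)
  | 0 => hδ0 ▸ hψ₀
  | n + 1 => contDiff_two_duhamel (F := fun z : ℝ × ℝ => -(V z.2 * δ n z))
      (Φ := fun q => ∫ y in (0 : ℝ)..q.2, -(V y * δ n (q.1, y)))
      (contDiff_one_source hV (contDiff_picard hV hψ₀ hδ0 hδ n)) (fun _ _ => rfl) (hδ n)

/-- **Equations of the Picard iterates**: `□ δ (n+1) = −V δ n` (Fréchet second partials). -/
theorem wave_picard_succ (hV : ContDiff ℝ 1 V) (hψ₀ : ContDiff ℝ 2 ψ₀) (hδ0 : δ 0 = ψ₀)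
    (hδ : ∀ n t x, δ (n + 1) (t, x) = (1 / 2) * ∫ s in (0 : ℝ)..t,
      ((∫ y in (0 : ℝ)..(x + (t - s)), -(V y * δ n (s, y)))
        - ∫ y in (0 : ℝ)..(x - (t - s)), -(V y * δ n (s, y)))) (n : ℕ) (z : ℝ × ℝ) :
    fderiv ℝ (fderiv ℝ (δ (n + 1))) z (1, 0) (1, 0) - fderiv ℝ (fderiv ℝ (δ (n + 1))) z (0, 1) (0, 1)
      = -(V z.2 * δ n z) :=
  duhamel_wave_eq' (F := fun z : ℝ × ℝ => -(V z.2 * δ n z))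
    (Φ := fun q => ∫ y in (0 : ℝ)..q.2, -(V y * δ n (q.1, y)))
    (contDiff_one_source hV (contDiff_picard hV hψ₀ hδ0 hδ n)) (fun _ _ => rfl) (hδ n) z

/-- **Data of the Picard iterates**: `δ (n+1) (0, ·) = 0` and `∂δ(n+1)(0, ·) = 0`. -/
theorem picard_succ_zero (hV : ContDiff ℝ 1 V) (hψ₀ : ContDiff ℝ 2 ψ₀) (hδ0 : δ 0 = ψ₀)
    (hδ : ∀ n t x, δ (n + 1) (t, x) = (1 / 2) * ∫ s in (0 : ℝ)..t,
      ((∫ y in (0 : ℝ)..(x + (t - s)), -(V y * δ n (s, y)))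
        - ∫ y in (0 : ℝ)..(x - (t - s)), -(V y * δ n (s, y)))) (n : ℕ) (x : ℝ) (v : ℝ × ℝ) :
    δ (n + 1) (0, x) = 0 ∧ fderiv ℝ (δ (n + 1)) (0, x) v = 0 := by
  refine ⟨by rw [hδ]; simp, ?_⟩
  exact fderiv_duhamel_zero' (F := fun z : ℝ × ℝ => -(V z.2 * δ n z))
    (Φ := fun q => ∫ y in (0 : ℝ)..q.2, -(V y * δ n (q.1, y)))
    (contDiff_one_source hV (contDiff_picard hV hψ₀ hδ0 hδ n)) (fun _ _ => rfl) (hδ n) x v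

end Picard

section PicardBounds

variable {V : ℝ → ℝ} {ψ₀ : ℝ × ℝ → ℝ} {δ : ℕ → ℝ × ℝ → ℝ}

/-- The sup norm on `ℝ × ℝ` is dominated by `|v₁| + |v₂|`. -/
theorem norm_le_abs_add_abs (v : ℝ × ℝ) : ‖v‖ ≤ |v.1| + |v.2| := by
  rw [Prod.norm_def, Real.norm_eq_abs, Real.norm_eq_abs]
  exact max_le (le_add_of_nonneg_right (abs_nonneg _)) (le_add_of_nonneg_left (abs_nonneg _))

/-- The light-cone triangle `{|x| + |t| ≤ R}` is compact. -/
theorem isCompact_triangle (R : ℝ) : IsCompact {z : ℝ × ℝ | |z.2| + |z.1| ≤ R} := by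
  refine (isCompact_closedBall (0 : ℝ × ℝ) R).of_isClosed_subset ?_ ?_
  · exact isClosed_le (by fun_prop) continuous_const
  · intro z hz
    simp only [mem_setOf_eq] at hz
    rw [Metric.mem_closedBall, dist_zero_right]
    have := norm_le_abs_add_abs z
    linarith [abs_nonneg z.1, abs_nonneg z.2]

/-- **Geometric bounds for the Picard iterates on light-cone triangles.** For `V ∈ C¹`, `ψ₀ ∈ C²`
and the iterates `δ 0 = ψ₀`, `δ (n+1) = D(−V δ n)`, on `{|x| + |t| ≤ R}` the iterates, their first
and their second partials are bounded by `A · 2⁻ⁿ · e^{L|t|}` (weighted-in-time contraction: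
`L = 2RK₀ + 1`, `K₀ = sup_{|x|≤R}|V|`). [folklore] -/
theorem picard_bounds (hV : ContDiff ℝ 1 V) (hψ₀ : ContDiff ℝ 2 ψ₀) (hδ0 : δ 0 = ψ₀)
    (hδ : ∀ n t x, δ (n + 1) (t, x) = (1 / 2) * ∫ s in (0 : ℝ)..t,
      ((∫ y in (0 : ℝ)..(x + (t - s)), -(V y * δ n (s, y)))
        - ∫ y in (0 : ℝ)..(x - (t - s)), -(V y * δ n (s, y)))) {R : ℝ} (hR0 : 0 ≤ R) :
    ∃ L : ℝ, 0 < L ∧ ∃ A₀ A₁ A₂ : ℝ, 0 ≤ A₀ ∧ 0 ≤ A₁ ∧ 0 ≤ A₂ ∧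
      ∀ (n : ℕ) (z : ℝ × ℝ), |z.2| + |z.1| ≤ R →
        |δ n z| ≤ A₀ * (1 / 2) ^ n * Real.exp (L * |z.1|) ∧
        (∀ v : ℝ × ℝ, |fderiv ℝ (δ n) z v|
          ≤ (|v.1| + |v.2|) * (A₁ * (1 / 2) ^ n) * Real.exp (L * |z.1|)) ∧
        (∀ v w : ℝ × ℝ, |fderiv ℝ (fderiv ℝ (δ n)) z v w|
          ≤ (|v.1| + |v.2|) * (|w.1| + |w.2|) * (A₂ * (1 / 2) ^ n) * Real.exp (L * |z.1|)) := by
  have hreg := contDiff_picard hV hψ₀ hδ0 hδ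
  -- bounds for `V`, `V'` on `[-R, R]`
  obtain ⟨K₀', hK₀'⟩ := (isCompact_Icc (a := -R) (b := R)).exists_bound_of_continuousOn
    hV.continuous.continuousOn
  obtain ⟨K₁', hK₁'⟩ := (isCompact_Icc (a := -R) (b := R)).exists_bound_of_continuousOn
    (hV.continuous_deriv le_rfl).continuousOn
  set K₀ := max K₀' 0 with hK₀def
  set K₁ := max K₁' 0 with hK₁def
  have hK₀ : 0 ≤ K₀ := le_max_right _ _
  have hK₁ : 0 ≤ K₁ := le_max_right _ _
  have hVb : ∀ z : ℝ × ℝ, |z.2| + |z.1| ≤ R → |V z.2| ≤ K₀ := fun z hz => by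
    have hx : z.2 ∈ Icc (-R) R := by
      constructor <;> linarith [abs_nonneg z.1, abs_le.1 (le_refl |z.2|), neg_abs_le z.2, le_abs_self z.2]
    exact ((Real.norm_eq_abs _).symm.le.trans (hK₀' z.2 hx)).trans (le_max_left _ _)
  have hV'b : ∀ z : ℝ × ℝ, |z.2| + |z.1| ≤ R → |deriv V z.2| ≤ K₁ := fun z hz => by
    have hx : z.2 ∈ Icc (-R) R := by
      constructor <;> linarith [abs_nonneg z.1, neg_abs_le z.2, le_abs_self z.2]
    exact ((Real.norm_eq_abs _).symm.le.trans (hK₁' z.2 hx)).trans (le_max_left _ _)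
  -- bounds for `ψ₀` and its first two derivatives on the triangle
  have hT := isCompact_triangle R
  obtain ⟨M₀', hM₀'⟩ := hT.exists_bound_of_continuousOn hψ₀.continuous.continuousOn
  obtain ⟨M₁', hM₁'⟩ := hT.exists_bound_of_continuousOn (hψ₀.continuous_fderiv (by norm_num)).continuousOn
  obtain ⟨M₂', hM₂'⟩ := hT.exists_bound_of_continuousOn
    ((hψ₀.fderiv_right (m := 1) (by norm_num)).continuous_fderiv (by norm_num)).continuousOn
  set M₀ := max M₀' 0 with hM₀def
  set M₁ := max M₁' 0 with hM₁def
  set M₂ := max M₂' 0 with hM₂def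
  have hM₀ : 0 ≤ M₀ := le_max_right _ _
  have hM₁ : 0 ≤ M₁ := le_max_right _ _
  have hM₂ : 0 ≤ M₂ := le_max_right _ _
  -- the weight
  set L : ℝ := 2 * R * K₀ + 1 with hLdef
  have hR : ∀ z : ℝ × ℝ, |z.2| + |z.1| ≤ R → 0 ≤ R := fun z hz => le_trans (by positivity) hz
  refine ⟨L, by positivity, M₀, max M₁ (2 * K₀ * M₀ / L),
    max M₂ (2 * (K₀ * M₀ + (K₁ * M₀ + K₀ * max M₁ (2 * K₀ * M₀ / L)) / L)), hM₀,
    le_max_of_le_left hM₁, le_max_of_le_left hM₂, ?_⟩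
  set A₁ := max M₁ (2 * K₀ * M₀ / L) with hA₁def
  have hL : 0 < L := by positivity
  have hA₁ : 0 ≤ A₁ := le_max_of_le_left hM₁
  have hexp : ∀ t : ℝ, 1 ≤ Real.exp (L * |t|) := fun t => Real.one_le_exp (by positivity)
  -- Stage A: the iterates
  have hA : ∀ (n : ℕ) (z : ℝ × ℝ), |z.2| + |z.1| ≤ R →
      |δ n z| ≤ M₀ * (1 / 2) ^ n * Real.exp (L * |z.1|) := by
    intro n
    induction n with
    | zero =>
      intro z hz
      rw [hδ0, pow_zero, mul_one]
      have h1 : |ψ₀ z| ≤ M₀ := ((Real.norm_eq_abs _).symm.le.trans (hM₀' z hz)).trans (le_max_left _ _)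
      nlinarith [hexp z.1]
    | succ n ih =>
      intro z hz
      have hFc : Continuous fun z : ℝ × ℝ => -(V z.2 * δ n z) :=
        (contDiff_one_source hV (hreg n)).continuous
      have hb : ∀ z : ℝ × ℝ, |z.2| + |z.1| ≤ R →
          |(fun z : ℝ × ℝ => -(V z.2 * δ n z)) z| ≤ K₀ * (M₀ * (1 / 2) ^ n) * Real.exp (L * |z.1|) := by
        intro z hz
        simp only [abs_neg, abs_mul]
        have h1 := hVb z hz
        have h2 := ih z hz
        have h3 : 0 ≤ |δ n z| := abs_nonneg _
        calc |V z.2| * |δ n z| ≤ K₀ * (M₀ * (1 / 2) ^ n * Real.exp (L * |z.1|)) := by gcongr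
          _ = K₀ * (M₀ * (1 / 2) ^ n) * Real.exp (L * |z.1|) := by ring
      have h := duhamel_bound hFc (hδ n) hL (by positivity) hb z hz
      refine h.trans ?_
      have hRz := hR z hz
      have hq : R * K₀ / L ≤ 1 / 2 := by
        rw [div_le_iff₀ hL, hLdef]
        nlinarith
      have e0 : 0 ≤ M₀ * (1 / 2) ^ n * Real.exp (L * |z.1|) := by positivity
      calc R * (K₀ * (M₀ * (1 / 2) ^ n)) / L * Real.exp (L * |z.1|)
          = (R * K₀ / L) * (M₀ * (1 / 2) ^ n * Real.exp (L * |z.1|)) := by ring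
        _ ≤ (1 / 2) * (M₀ * (1 / 2) ^ n * Real.exp (L * |z.1|)) := by gcongr
        _ = M₀ * (1 / 2) ^ (n + 1) * Real.exp (L * |z.1|) := by ring
  -- Stage B: first partials
  have hB : ∀ (n : ℕ) (z : ℝ × ℝ), |z.2| + |z.1| ≤ R → ∀ v : ℝ × ℝ,
      |fderiv ℝ (δ n) z v| ≤ (|v.1| + |v.2|) * (A₁ * (1 / 2) ^ n) * Real.exp (L * |z.1|) := by
    intro n
    cases n with
    | zero =>
      intro z hz v
      rw [hδ0, pow_zero, mul_one]
      have h1 : ‖fderiv ℝ ψ₀ z‖ ≤ M₁ := (hM₁' z hz).trans (le_max_left _ _)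
      have h2 : |fderiv ℝ ψ₀ z v| ≤ M₁ * (|v.1| + |v.2|) := by
        rw [← Real.norm_eq_abs]
        refine ((fderiv ℝ ψ₀ z).le_opNorm v).trans ?_
        gcongr
        exact norm_le_abs_add_abs v
      have h3 : M₁ ≤ A₁ := le_max_left _ _
      have h4 : 0 ≤ |v.1| + |v.2| := by positivity
      calc |fderiv ℝ ψ₀ z v| ≤ M₁ * (|v.1| + |v.2|) := h2
        _ ≤ A₁ * (|v.1| + |v.2|) * Real.exp (L * |z.1|) := by nlinarith [hexp z.1, mul_nonneg hA₁ h4]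
        _ = (|v.1| + |v.2|) * A₁ * Real.exp (L * |z.1|) := by ring
    | succ n =>
      intro z hz v
      have hF1 : ContDiff ℝ 1 fun z : ℝ × ℝ => -(V z.2 * δ n z) := contDiff_one_source hV (hreg n)
      have hb : ∀ z : ℝ × ℝ, |z.2| + |z.1| ≤ R →
          |(fun z : ℝ × ℝ => -(V z.2 * δ n z)) z| ≤ K₀ * (M₀ * (1 / 2) ^ n) * Real.exp (L * |z.1|) := by
        intro z hz
        simp only [abs_neg, abs_mul]
        have h1 := hVb z hz
        have h2 := hA n z hz
        have h3 : 0 ≤ |δ n z| := abs_nonneg _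
        calc |V z.2| * |δ n z| ≤ K₀ * (M₀ * (1 / 2) ^ n * Real.exp (L * |z.1|)) := by gcongr
          _ = K₀ * (M₀ * (1 / 2) ^ n) * Real.exp (L * |z.1|) := by ring
      have h := fderiv_duhamel_bound hF1 (hδ n) hL (by positivity) hb z hz v
      refine h.trans ?_
      have h4 : 0 ≤ |v.1| + |v.2| := by positivity
      have h5 : 2 * K₀ * M₀ / L ≤ A₁ := le_max_right _ _
      calc (|v.1| + |v.2|) * (K₀ * (M₀ * (1 / 2) ^ n) / L) * Real.exp (L * |z.1|)
          = (|v.1| + |v.2|) * ((2 * K₀ * M₀ / L) * (1 / 2) ^ (n + 1)) * Real.exp (L * |z.1|) := by ring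
        _ ≤ (|v.1| + |v.2|) * (A₁ * (1 / 2) ^ (n + 1)) * Real.exp (L * |z.1|) := by gcongr
  -- Stage C: second partials
  refine fun n z hz => ⟨hA n z hz, hB n z hz, ?_⟩
  cases n with
  | zero =>
    intro v w
    rw [hδ0, pow_zero, mul_one]
    have h1 : ‖fderiv ℝ (fderiv ℝ ψ₀) z‖ ≤ M₂ := (hM₂' z hz).trans (le_max_left _ _)
    have h2 : |fderiv ℝ (fderiv ℝ ψ₀) z v w| ≤ M₂ * (|v.1| + |v.2|) * (|w.1| + |w.2|) := by
      rw [← Real.norm_eq_abs]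
      refine ((fderiv ℝ (fderiv ℝ ψ₀) z).le_opNorm₂ v w).trans ?_
      gcongr
      · exact norm_le_abs_add_abs v
      · exact norm_le_abs_add_abs w
    have h3 : M₂ ≤ max M₂ (2 * (K₀ * M₀ + (K₁ * M₀ + K₀ * A₁) / L)) := le_max_left _ _
    have h4 : 0 ≤ (|v.1| + |v.2|) * (|w.1| + |w.2|) := by positivity
    calc |fderiv ℝ (fderiv ℝ ψ₀) z v w| ≤ M₂ * ((|v.1| + |v.2|) * (|w.1| + |w.2|)) := by linarith [h2]
      _ ≤ max M₂ (2 * (K₀ * M₀ + (K₁ * M₀ + K₀ * A₁) / L)) * ((|v.1| + |v.2|) * (|w.1| + |w.2|))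
          * Real.exp (L * |z.1|) := by
          nlinarith [hexp z.1, mul_nonneg (hM₂.trans h3) h4, mul_le_mul_of_nonneg_right h3 h4]
      _ = (|v.1| + |v.2|) * (|w.1| + |w.2|) * max M₂ (2 * (K₀ * M₀ + (K₁ * M₀ + K₀ * A₁) / L))
          * Real.exp (L * |z.1|) := by ring
  | succ n =>
    intro v w
    have hF1 : ContDiff ℝ 1 fun z : ℝ × ℝ => -(V z.2 * δ n z) := contDiff_one_source hV (hreg n)
    have hb : ∀ z : ℝ × ℝ, |z.2| + |z.1| ≤ R →
        |(fun z : ℝ × ℝ => -(V z.2 * δ n z)) z| ≤ K₀ * (M₀ * (1 / 2) ^ n) * Real.exp (L * |z.1|) := by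
      intro z hz
      simp only [abs_neg, abs_mul]
      have h1 := hVb z hz
      have h2 := hA n z hz
      have h3 : 0 ≤ |δ n z| := abs_nonneg _
      calc |V z.2| * |δ n z| ≤ K₀ * (M₀ * (1 / 2) ^ n * Real.exp (L * |z.1|)) := by gcongr
        _ = K₀ * (M₀ * (1 / 2) ^ n) * Real.exp (L * |z.1|) := by ring
    have hb1 : ∀ z : ℝ × ℝ, |z.2| + |z.1| ≤ R →
        |fderiv ℝ (fun z : ℝ × ℝ => -(V z.2 * δ n z)) z (0, 1)|
          ≤ (K₁ * M₀ + K₀ * A₁) * (1 / 2) ^ n * Real.exp (L * |z.1|) := by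
      intro z hz
      rw [fderiv_source_apply hV ((hreg n).differentiable (by norm_num)) z, abs_neg]
      have h1 := hV'b z hz
      have h2 := hA n z hz
      have h3 := hB n z hz (0, 1)
      simp only [abs_zero, abs_one, zero_add, one_mul] at h3
      have h4 := hVb z hz
      calc |deriv V z.2 * δ n z + V z.2 * fderiv ℝ (δ n) z (0, 1)|
          ≤ |deriv V z.2| * |δ n z| + |V z.2| * |fderiv ℝ (δ n) z (0, 1)| := by
            refine (abs_add_le _ _).trans ?_
            rw [abs_mul, abs_mul]
        _ ≤ K₁ * (M₀ * (1 / 2) ^ n * Real.exp (L * |z.1|))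
            + K₀ * (A₁ * (1 / 2) ^ n * Real.exp (L * |z.1|)) := by
            gcongr
        _ = (K₁ * M₀ + K₀ * A₁) * (1 / 2) ^ n * Real.exp (L * |z.1|) := by ring
    have h := fderiv_fderiv_duhamel_bound hF1 (hδ n) hL (by positivity) hb hb1 z hz v w
    refine h.trans ?_
    have h4 : 0 ≤ (|v.1| + |v.2|) * (|w.1| + |w.2|) := by positivity
    have h5 : 2 * (K₀ * M₀ + (K₁ * M₀ + K₀ * A₁) / L)
        ≤ max M₂ (2 * (K₀ * M₀ + (K₁ * M₀ + K₀ * A₁) / L)) := le_max_right _ _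
    calc (|v.1| + |v.2|) * (|w.1| + |w.2|) * (K₀ * (M₀ * (1 / 2) ^ n)
          + (K₁ * M₀ + K₀ * A₁) * (1 / 2) ^ n / L) * Real.exp (L * |z.1|)
        = (|v.1| + |v.2|) * (|w.1| + |w.2|) * ((2 * (K₀ * M₀ + (K₁ * M₀ + K₀ * A₁) / L))
          * (1 / 2) ^ (n + 1)) * Real.exp (L * |z.1|) := by ring
      _ ≤ (|v.1| + |v.2|) * (|w.1| + |w.2|) * (max M₂ (2 * (K₀ * M₀ + (K₁ * M₀ + K₀ * A₁) / L))
          * (1 / 2) ^ (n + 1)) * Real.exp (L * |z.1|) := by gcongr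

end PicardBounds

end WaveEnergy

end

end Summit.FinalStateConjecture.FinalStateConjecture.Theorems
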